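import Summits.ValiantsHypothesis.ValiantsHypothesis.Theses.DivisionGap
import Summits.ValiantsHypothesis.ValiantsHypothesis.Theorems.DivisionGapDefs
import Summits.ValiantsHypothesis.ValiantsHypothesis.Theorems.DivisionGapPerDivisionHardStubTorusSupport
import Summits.ValiantsHypothesis.ValiantsHypothesis.Theorems.DivisionGapPerDivisionHardStubFaceDescent
import Summits.ValiantsHypothesis.ValiantsHypothesis.Theorems.DivisionGapPerDivisionHardStubJssContraction
import Summits.ValiantsHypothesis.ValiantsHypothesis.Theorems.DivisionGapPerDivisionHardStubBlockArsenal
import Summits.ValiantsHypothesis.ValiantsHypothesis.Theorems.DivisionGapPerDivisionHardStubColContentRigid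
import Summits.ValiantsHypothesis.ValiantsHypothesis.Theorems.DivisionGapPerDivisionHardStubTorusSplit

/-!
# Crux `DivisionGap.PerDivisionHard` (stmt-ValiantsHypothesis-5065) — the COLUMN-CONTENT RUNG and the
ROW-SPLIT RUNG, unconditionally (monotone rank across one balanced row cut)

`PerDivisionHard` asks, for every `c` and all large `n`, that every nonzero cofactor
`h ∈ ℝ≥0[x_ij]` satisfies `2^{(log₂ n + c)^c} < L(per_n · h) + L(h)` (monotone fan-in-two
`complexity` over `ℝ≥0`).  For a row set `A ⊆ [n]` and a monomial `x^m` let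
`colContent_A(m) := (Σ_{r ∈ A} m(r,c))_c ∈ ℕ^n` be the vector of column margins of the `A`-rows of
`m`, and `V_A(h) := {colContent_A(m) : m ∈ supp h}`.  `|V_A(h)|` is the support-level MONOTONE RANK
of `h` across the row cut `(A, Aᶜ)` — the nonnegative version of Nisan's partial-derivative /
ROABP-width measure for the partition of the variables into the rows of `A` and the other rows.
This file proves the crux inequality for every cofactor of quasi-polynomial rank across SOME balanced
row cut:

* `perDivisionHard_colContent` — **∀ c, ∃ n₀, ∀ n ≥ n₀, ∀ h ≠ 0, ∀ A with `n ≤ 4|A| ≤ 3n`: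
  `|V_A(h)| ≤ 2^{(log₂ n + c)^c}` ⇒ `2^{(log₂ n + c)^c} < L(per_n · h) + L(h)`** (no degree,
  sparsity, torus or circuit hypothesis on `h`);
* `perDivisionHard_rowSplit` — **the same conclusion for every `h = Σ_{t<W} f_t · g_t ≠ 0` with
  `W ≤ 2^{(log₂ n + c)^c}`, every `f_t` in the variables of the rows of `A` and every `g_t` in the
  variables of the other rows, `f_t, g_t` otherwise ARBITRARY** (`W = 1`: a cofactor that factors
  across a balanced row cut never helps, however dense, high-degree or expensive the two factors).

They are the compositions `perDivisionHard_colContent_of` / `perDivisionHard_rowSplit_of` of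
skeleton v13 of line `pair-descent-jss-endpoint`
(`Cruxes/PerDivisionHard/Lines/pair_descent_jss_endpoint.lean`) with every stub a landed theorem:
torus normal form keeping a sub-support (`stub_torusSupport`, so `|V_A|` does not grow) resp. WITHIN
the row-split class (`stub_torusSplit`, so `|V_A(h')| ≤ W`) → an ALTERNATING placement of the
subdivided block `G(b,k) ⊕ M₀` (the `k` internal rows of every subdivision path alternate between `A`
and `Aᶜ`; a nonzero circulation of the placed graph is constant in absolute value along a path, so
its `A`-column-sums are nonzero on `≥ k - 1` core columns; core columns chosen by the union bound over
the `≤ |V_A|²` pairs of values) on which the top fibre of the cofactor is a single monomial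
(`stub_colContentRigid`) → face descent to `x^u · per_G` (`stub_faceDescent`) → the monomial is
stripped at polynomial cost (`stub_jssContraction`, Jukna–Seiwert–Sergeev) → the placed face is
harder than that (`stub_blockArsenal`, Jerrum–Snir by support through the phase bijection).

The column-content rung contains the sparse rung (`|V_A| ≤ |supp h|`,
`Theorems/DivisionGapPerDivisionHardSparse.lean`) and the rows-avoided rung for `|A| ≥ n/4`
(`V_A = {0}`), and covers row-ROABPs of quasi-polynomial width in any row order (prefix cut of
`n/2` rows).  What it says about the residual of the crux: an undecided cofactor has
super-quasi-polynomially many `A`-column contents on EVERY balanced row set `A` — full monotone rank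
across every balanced row cut, as the permanent itself.
-/

noncomputable section

-- `Summit.ValiantsHypothesis.ValiantsHypothesis.…` is the tree's mandated single-conjunct layout
-- (Sub = Summit), so the duplicated namespace component is intended.
set_option linter.dupNamespace false

namespace Summit.ValiantsHypothesis.ValiantsHypothesis.Theorems.DivisionGapPerDivisionHard

open MvPolynomial Literature.Computability.AlgebraicComplexity
open scoped NNReal

/-- The common endpoint of both rungs: a nonzero torus-homogeneous `h'` of small `A`-column-content
rank that is no more expensive than the pair `(per · h, h)` forces the crux inequality for `h`.
(Rigidity `stub_colContentRigid` → face descent → JSS contraction → block arsenal.) [folklore] -/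
theorem two_pow_lt_pair_of_colContent (c : ℕ) :
    ∃ n₀ : ℕ, ∀ n ≥ n₀, ∀ h h' : MvPolynomial (Fin n × Fin n) ℝ≥0, h' ≠ 0 → IsTorusHomogeneous h' →
      complexity (perPoly (Fin n) ℝ≥0 * h') ≤ complexity (perPoly (Fin n) ℝ≥0 * h) →
      ∀ A : Finset (Fin n), n ≤ 4 * A.card → 4 * A.card ≤ 3 * n →
      (h'.support.image fun (mm : (Fin n × Fin n) →₀ ℕ) (cc : Fin n) => ∑ r ∈ A, mm (r, cc)).card ≤
          2 ^ ((Nat.log 2 n + c) ^ c) →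
      2 ^ ((Nat.log 2 n + c) ^ c) < complexity (perPoly (Fin n) ℝ≥0 * h) + complexity h := by
  obtain ⟨κ, hcon⟩ := stub_jssContraction
  obtain ⟨d, n₁, hhard⟩ := stub_blockArsenal c κ
  obtain ⟨n₀, hS⟩ := stub_colContentRigid c d
  refine ⟨n₀ + n₁, ?_⟩
  intro n hn h h' hh' htor hle1 A hA₁ hA₂ hcard
  by_contra hlt
  have hle : complexity (perPoly (Fin n) ℝ≥0 * h) + complexity h ≤
      2 ^ ((Nat.log 2 n + c) ^ c) := not_lt.mp hlt
  obtain ⟨b, k, m, eR, eC, w, u, hb, hcut, hsingle⟩ := hS n (by omega) h' hh' htor A hA₁ hA₂ hcard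
  -- face descent: `x^u · per_G` is (up to one gate) no more expensive than `per · h'`
  have hdesc := stub_faceDescent n (placedBlock eR eC) w h' u hcut hh' hsingle
  have h1 : complexity (monomial u (1 : ℝ≥0) * facePer (placedBlock eR eC)) ≤
      2 ^ ((Nat.log 2 n + c) ^ c) + 1 :=
    calc complexity (monomial u (1 : ℝ≥0) * facePer (placedBlock eR eC))
        ≤ complexity (perPoly (Fin n) ℝ≥0 * h') + 1 := hdesc
      _ ≤ complexity (perPoly (Fin n) ℝ≥0 * h) + 1 := Nat.add_le_add_right hle1 1
      _ ≤ 2 ^ ((Nat.log 2 n + c) ^ c) + 1 :=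
          Nat.add_le_add_right (le_trans (Nat.le_add_right _ _) hle) 1
  -- JSS contraction: strip the monomial at polynomial cost
  have h2 : complexity (facePer (placedBlock eR eC)) ≤
      ((n + 2) * (2 ^ ((Nat.log 2 n + c) ^ c) + 3)) ^ κ :=
    calc complexity (facePer (placedBlock eR eC))
        ≤ ((n + 2) * (complexity (monomial u (1 : ℝ≥0) * facePer (placedBlock eR eC)) + 2)) ^ κ :=
          hcon n (facePer (placedBlock eR eC)) u
      _ ≤ ((n + 2) * (2 ^ ((Nat.log 2 n + c) ^ c) + 3)) ^ κ :=
          Nat.pow_le_pow_left (Nat.mul_le_mul_left _ (by omega)) κ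
  -- the placed block face is harder than that
  have h3 := hhard n (by omega) b k m eR eC hb
  exact absurd (lt_of_lt_of_le h3 h2) (lt_irrefl _)

/-- **The column-content rung of `PerDivisionHard`.**  For every `c` there is `n₀` such that for all
`n ≥ n₀`, every nonzero `h ∈ ℝ≥0[x_ij]` (`n × n` matrix variables) and every row set `A` with
`n ≤ 4|A| ≤ 3n`: if the monomials of `h` have at most `2^{(log₂ n + c)^c}` distinct
`A`-column-content vectors `(Σ_{r∈A} m(r,c))_c`, then `2^{(log₂ n + c)^c} < L(per_n · h) + L(h)` in
the monotone fan-in-two `complexity` over `ℝ≥0` — the permanent admits no quasi-polynomially cheap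
monotone pair whose cofactor has quasi-polynomial monotone rank across some balanced row cut.  The
torus normal form keeps a sub-support (`stub_torusSupport`), hence does not increase the number of
column contents; then `two_pow_lt_pair_of_colContent`. [folklore] -/
theorem perDivisionHard_colContent :
    ∀ c : ℕ, ∃ n₀ : ℕ, ∀ n ≥ n₀, ∀ h : MvPolynomial (Fin n × Fin n) ℝ≥0, h ≠ 0 →
      ∀ A : Finset (Fin n), n ≤ 4 * A.card → 4 * A.card ≤ 3 * n →
      (h.support.image fun (mm : (Fin n × Fin n) →₀ ℕ) (cc : Fin n) => ∑ r ∈ A, mm (r, cc)).card ≤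
          2 ^ ((Nat.log 2 n + c) ^ c) →
      2 ^ ((Nat.log 2 n + c) ^ c) <
        complexity (perPoly (Fin n) ℝ≥0 * h) + complexity h := by
  intro c
  obtain ⟨n₀, hmain⟩ := two_pow_lt_pair_of_colContent c
  refine ⟨n₀, fun n hn h hh A hA₁ hA₂ hcard => ?_⟩
  obtain ⟨h', hh', htor, hsupp, hle1, -⟩ := stub_torusSupport n h hh
  exact hmain n hn h h' hh' htor hle1 A hA₁ hA₂
    (le_trans (Finset.card_le_card (Finset.image_subset_image hsupp)) hcard)

/-- **The row-split rung of `PerDivisionHard`.**  For every `c` there is `n₀` such that for all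
`n ≥ n₀`, every row set `A` with `n ≤ 4|A| ≤ 3n`, every `W ≤ 2^{(log₂ n + c)^c}` and all families
`f, g : Fin W → ℝ≥0[x_ij]` with every `f_t` in the variables of the rows of `A` and every `g_t` in
the variables of the rows outside `A`: if `h = Σ_t f_t · g_t ≠ 0` then
`2^{(log₂ n + c)^c} < L(per_n · h) + L(h)` — whatever the degrees, supports and costs of the
`f_t, g_t` (monotone rank `≤ 2^B` across one balanced row cut; `W = 1`: a cofactor factoring across a
balanced row cut).  The torus normal form within the class (`stub_torusSplit`) has at most `W`
column contents; then `two_pow_lt_pair_of_colContent`. [folklore] -/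
theorem perDivisionHard_rowSplit :
    ∀ c : ℕ, ∃ n₀ : ℕ, ∀ n ≥ n₀, ∀ (W : ℕ) (A : Finset (Fin n))
      (f g : Fin W → MvPolynomial (Fin n × Fin n) ℝ≥0),
      n ≤ 4 * A.card → 4 * A.card ≤ 3 * n → W ≤ 2 ^ ((Nat.log 2 n + c) ^ c) →
      ∑ t, f t * g t ≠ 0 →
      (∀ t, ∀ mm ∈ (f t).support, ∀ e ∈ mm.support, e.1 ∈ A) →
      (∀ t, ∀ mm ∈ (g t).support, ∀ e ∈ mm.support, e.1 ∉ A) →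
      2 ^ ((Nat.log 2 n + c) ^ c) <
        complexity (perPoly (Fin n) ℝ≥0 * ∑ t, f t * g t) + complexity (∑ t, f t * g t) := by
  intro c
  obtain ⟨n₀, hmain⟩ := two_pow_lt_pair_of_colContent c
  refine ⟨n₀, fun n hn W A f g hA₁ hA₂ hW hh hf hg => ?_⟩
  obtain ⟨h', hh', htor, hcardW, hle1, -⟩ := stub_torusSplit n W A f g hh hf hg
  exact hmain n hn _ h' hh' htor hle1 A hA₁ hA₂ (hcardW.trans hW)

end Summit.ValiantsHypothesis.ValiantsHypothesis.Theorems.DivisionGapPerDivisionHard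

end
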